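import Literature.AlgebraicGeometry.Motives.ProjectiveOfGeneratingSections
import Literature.AlgebraicGeometry.Motives.ProjectiveSpaceFieldPoints
import Literature.AlgebraicGeometry.Motives.RuledSurfaceRelation
import Literature.AlgebraicGeometry.Motives.VerticalLimitsOfLines
import HarnessLib

/-!
# Germs of chart coordinates along a morphism to `ℙⁿ`, evaluated at the generic point

For an integral `k`-scheme `T`, a `k`-morphism `f : T → ℙⁿ_k`, and the generic point of `T` read
as a `k(T)`-point of `ℙⁿ` with homogeneous coordinates `P ∈ k(T)ⁿ⁺¹` (`qgen T ≫ f = [P]`): if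
`t ∈ f⁻¹D₊(x_a)` then `P_a ≠ 0`, and the germs at `t` of the pulled-back chart coordinates
`f^*(x_c/x_a) ∈ Γ(T, f⁻¹D₊(x_a))` (`GeneratingSections.homRatio`) are elements of `𝒪_{T,t}` whose
images in `k(T)` are `P_c / P_a` (`ProjFamily.algebraMap_germ_homRatio`). This is the statement
"a morphism to `ℙⁿ` has, near every point, integral homogeneous coordinates with a unit
coordinate", in the form consumed by the vertical-limit theorems of
`Motives/PlaneFamilyRelation`, `Motives/FibreVerticalLines` (integral vectors with controlled
values at the generic point). Everything is proved; no definitions.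

## References

* [Hartshorne1977] R. Hartshorne, *Algebraic Geometry*, II Prop. 2.5, II Thm. 7.1 (a).
* [GortzWedhorn2020] U. Görtz, T. Wedhorn, *Algebraic Geometry I*, 2nd ed., (13.8), Prop. 3.33.
-/

noncomputable section

open CategoryTheory CategoryTheory.Limits AlgebraicGeometry MvPolynomial TopologicalSpace Opposite
  HomogeneousLocalization

universe u

namespace Literature.AlgebraicGeometry.Motives

attribute [local instance] MvPolynomial.gradedAlgebra ProjBaseChange.algebraBase
  ProjFamily.functionFieldAlgebra

namespace ProjFamily

open Segre GeneratingSections ProjectiveSpace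

variable {k : Type u} [Field k] {n : ℕ} (T : SchemeOver k) [IsIntegral T.left]

/-- The sections of `𝒪_{Spec k(T)}` pulled back along the generic point `Spec k(T) → T` from an
open `U ∋ η` are the germs at `η`: `Γ(k(T)) ≅ k(T)` identifies `(qgen T)^*|_U (s)` with `germ_U η (s)`
(Mathlib `Scheme.fromSpecStalk_app`). [folklore] -/
theorem ΓSpecIso_hom_qgen_appLE (U : T.left.Opens) (hη : genericPoint T.left ∈ U)
    (e : (⊤ : (Spec T.left.functionField).Opens) ≤ qgen T ⁻¹ᵁ U) (s : Γ(T.left, U)) :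
    (Scheme.ΓSpecIso T.left.functionField).hom ((qgen T).appLE U ⊤ e s) =
      T.left.presheaf.germ U (genericPoint T.left) hη s := by
  change (Scheme.ΓSpecIso T.left.functionField).hom
    (((T.left.fromSpecStalk (genericPoint T.left)).app U ≫
      (Spec T.left.functionField).presheaf.map (homOfLE e).op) s) = _
  rw [Scheme.fromSpecStalk_app hη]
  simp only [Category.assoc, ← Functor.map_comp]
  change ((T.left.presheaf.germ U (genericPoint T.left) hη ≫
    (Scheme.ΓSpecIso (T.left.presheaf.stalk (genericPoint T.left))).inv ≫
      (Spec T.left.functionField).presheaf.map _) ≫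
        (Scheme.ΓSpecIso T.left.functionField).hom) s = _
  have hid : ((homOfLE (le_top : qgen T ⁻¹ᵁ U ≤ ⊤)).op ≫ (homOfLE e).op :
      (op ⊤ : (Spec T.left.functionField).Opensᵒᵖ) ⟶ op ⊤) = 𝟙 _ := Subsingleton.elim _ _
  rw [hid, CategoryTheory.Functor.map_id, Category.comp_id, Category.assoc]
  erw [Iso.inv_hom_id]
  rw [Category.comp_id]

/-- **Germs of the chart coordinates `f^*(x_c/x_a)` have the values `P_c/P_a` at the generic
point.** Let `f : T → ℙⁿ_k` be a `k`-morphism from an integral `k`-scheme whose generic point is the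
`k(T)`-point `[P]`, `P ∈ k(T)ⁿ⁺¹` (`qgen T ≫ f = pointOfVec P`), and `t ∈ f⁻¹D₊(x_a)`. Then `P_a ≠ 0`
and, for every `c`, the germ at `t` of `f^*(x_c/x_a)` maps to `P_c / P_a` in `k(T)`.
[cite: Hartshorne1977, II Thm. 7.1 (a)] -/
theorem algebraMap_germ_homRatio (f : T ⟶ projectiveSpace n k)
    (P : Fin (n + 1) → T.left.functionField) (hP0 : P ≠ 0)
    (hP : qgen T ≫ f.left = (pointOfVec k P hP0).left)
    {t : T.left} {a : Fin (n + 1)} (ht : t ∈ preU f.left a) :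
    P a ≠ 0 ∧ ∀ c, algebraMap (T.left.presheaf.stalk t) T.left.functionField
      (T.left.presheaf.germ (preU f.left a) t ht (homRatio f.left a c)) = P c / P a := by
  -- the generic point lies in the chart and maps to `[P]`
  have hη : genericPoint T.left ∈ preU f.left a :=
    ((genericPoint_spec T.left).specializes (Set.mem_univ t)).mem_open (preU f.left a).isOpen ht
  have hqη : (qgen T).base (IsLocalRing.closedPoint T.left.functionField) = genericPoint T.left := by
    have h : (qgen T).base (IsLocalRing.closedPoint _) ∈ Set.range (qgen T).base := ⟨_, rfl⟩
    rwa [range_qgen, Set.mem_singleton_iff] at h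
  have hqx : ∀ x, (qgen T).base x = genericPoint T.left := fun x => by
    have h : (qgen T).base x ∈ Set.range (qgen T).base := ⟨_, rfl⟩
    rwa [range_qgen, Set.mem_singleton_iff] at h
  have e : (⊤ : (Spec T.left.functionField).Opens) ≤ qgen T ⁻¹ᵁ preU f.left a :=
    fun x _ => by change (qgen T).base x ∈ (preU f.left a : Set T.left); rw [hqx x]; exact hη
  have hfη : f.left.base (genericPoint T.left) = (pointOfVec k P hP0).pt := by
    rw [← hqη]
    change ((qgen T ≫ f.left).base (IsLocalRing.closedPoint _)) =
      (pointOfVec k P hP0).left.base (IsLocalRing.closedPoint _)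
    rw [hP]
    rfl
  have hPa : P a ≠ 0 := by
    have h : f.left.base (genericPoint T.left) ∈ Proj.basicOpen (grading (Fin (n + 1)) k) (X a) := hη
    rw [hfη] at h
    exact (pt_pointOfVec_mem_basicOpen_X_iff P hP0 a).1 h
  have hPa' : aeval P (X a : MvPolynomial (Fin (n + 1)) k) ≠ 0 := by rwa [aeval_X]
  refine ⟨hPa, fun c => ?_⟩
  haveI : Nonempty (preU f.left a) := ⟨⟨t, ht⟩⟩
  rw [Scheme.algebraMap_germ_eq_germToFunctionField]
  change T.left.presheaf.germ (preU f.left a) (genericPoint T.left) hη (homRatio f.left a c) = _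
  -- lift the generic point into the chart
  let q' : Spec T.left.functionField ⟶ ↑(preU f.left a) :=
    IsOpenImmersion.lift (preU f.left a).ι (qgen T) (by
      rw [Scheme.Opens.range_ι, range_qgen, Set.singleton_subset_iff]; exact hη)
  have hq' : q' ≫ (preU f.left a).ι = qgen T := IsOpenImmersion.lift_fac _ _ _
  -- on the chart, the generic point is `Spec` of the evaluation at `P`
  have hchart : q' ≫ chartLift f.left a =
      Spec.map (CommRingCat.ofHom (awayEval P hPa').toRingHom) := by
    haveI : Mono (chartι k a : Spec (.of (Away (grading (Fin (n + 1)) k) (X a))) ⟶ _) := inferInstance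
    refine (cancel_mono (chartι k a)).1 ?_
    have h1 : (q' ≫ chartLift f.left a) ≫ chartι k a = qgen T ≫ f.left := by
      rw [Category.assoc, chartLift_chartι, ← Category.assoc, hq']
      rfl
    rw [h1]
    exact hP.trans (by
      rw [pointOfVec_eq_chartPoint P hP0 (X_mem a) one_pos hPa', chartPoint_left])
  -- compute the germ through `Γ(Spec k(T)) ≅ k(T)`
  rw [← ΓSpecIso_hom_qgen_appLE T (preU f.left a) hη e]
  have happ : (qgen T).appLE (preU f.left a) ⊤ e (homRatio f.left a c) =
      q'.appTop (pull (chartLift f.left a) (frac k a c)) := by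
    have key : (preU f.left a).ι.appLE (preU f.left a) ⊤ (top_le_ι_preimage (preU f.left a)) =
        (preU f.left a).topIso.inv := by
      rw [Scheme.Opens.ι_appLE, Scheme.Opens.topIso_inv]
      exact congrArg (fun q ↦ T.left.presheaf.map (Quiver.Hom.op q)) (Subsingleton.elim _ _)
    have hcomp : (qgen T).appLE (preU f.left a) ⊤ e =
        (preU f.left a).ι.appLE (preU f.left a) ⊤ (top_le_ι_preimage (preU f.left a)) ≫
          q'.appLE ⊤ ⊤ le_top := by
      rw [Scheme.Hom.appLE_comp_appLE]
      congr 1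
      exact hq'.symm
    rw [hcomp, key, homRatio, CategoryTheory.comp_apply, Iso.hom_inv_id_apply]
    rfl
  rw [happ, pull_apply]
  change (Scheme.ΓSpecIso T.left.functionField).hom
    (((chartLift f.left a).appTop ≫ q'.appTop) ((Scheme.ΓSpecIso _).inv (frac k a c))) = _
  rw [← Scheme.Hom.comp_appTop, hchart]
  have hnat := CategoryTheory.congr_fun
    (Scheme.ΓSpecIso_naturality (CommRingCat.ofHom (awayEval P hPa').toRingHom))
    ((Scheme.ΓSpecIso (CommRingCat.of (Away (grading (Fin (n + 1)) k) (X a)))).inv (frac k a c))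
  simp only [CategoryTheory.comp_apply] at hnat
  rw [Iso.inv_hom_id_apply] at hnat
  have hnat' : (Scheme.ΓSpecIso T.left.functionField).hom
      ((Spec.map (CommRingCat.ofHom (awayEval P hPa').toRingHom)).appTop
        ((Scheme.ΓSpecIso (CommRingCat.of (Away (grading (Fin (n + 1)) k) (X a)))).inv (frac k a c))) =
      awayEval P hPa' (frac k a c) := hnat
  rw [hnat']
  rw [awayEval_apply, val_frac, awayEvalLoc_mk]
  simp [aeval_X, div_eq_mul_inv]
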